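import Summits.AtomisticToContinuum.Crystallization.Theses.NashClassCertificates
import Summits.AtomisticToContinuum.Crystallization.Theorems.NashClassCertificatesNashTwoShellGapNashSeparation
import Summits.AtomisticToContinuum.Crystallization.Theorems.PhononSlackCertificatesCoerciveTwoShellGapPeriodisation
import Summits.AtomisticToContinuum.Crystallization.Theorems.NashClassCertificatesNashTwoShellGapDiluteOfCrux

/-!
# Crux `NashTwoShellGap` (stmt-AtomisticToContinuum-16826), line `bulk_dilute`: the composition as a
# theorem of the tree, and — given the bulk gap — the crux IS the dilute Nash gap

The registered skeleton `Cruxes/NashTwoShellGap/Lines/bulk_dilute.lean` (crux-strategist s1, driven by the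
continuation lead c1) derives the crux from two stubs: the Nash-free flat BAD-PHASE GAP on the torus
(`stub_badPhaseGap`: for every density `β₀ > 0` a gap `γ > 0` for periodic configurations of `ℝ³` with
`1/3`-separated point set and bad motif fraction `≥ β₀`) and the DILUTE NASH GAP (`stub_diluteNashGap`: the
crux restricted to `1/2`-separated Nash configurations with at most `β₀ N` bad particles).  This file lands
the composition itself (`gap_of_bulk_of_dilute`, hypotheses = the two stub statements; registered name
`stub_bulkDiluteComposition`), so that the crux is CLOSED MODULO the two registered stubs by a tree theorem:
bootstrap `1/3 → 1/2` on the Nash class (`NashTwoShellGapNashSeparation.stub_nashSeparation`, landed), the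
dilute stub below density `β₀`, and above it periodisation (`CoarseTierTransfer.exists_periodicConfiguration`,
`separated_points`, `energyPerParticle_le`, `CoerciveTwoShellGapPeriodisation.card_bad_le`) into the bulk stub;
`g := min g_D γ`.  With the landed sandwich `NashTwoShellGapDiluteOfCrux.stub_diluteOfCrux` (crux ⇒ dilute) it
records that nothing is lost on the Nash side: GIVEN the bulk gap, the crux is EQUIVALENT to the dilute Nash gap
(`nashTwoShellGap_iff_dilute_of_bulk`).  No definitions; all `[folklore]`.
-/

noncomputable section

namespace Summit.AtomisticToContinuum.Crystallization.Theorems.NashTwoShellGapBulkDiluteComposition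

open scoped BigOperators Classical
open Literature.MathematicalPhysics.StatisticalMechanics Literature.Geometry.DiscreteGeometry
open Summit.AtomisticToContinuum.Crystallization.Theses

/-- **Composition lemma** of line `bulk_dilute` (hypothesis form; concludes the crux's BODY): bulk stub statement → dilute stub statement → the crux inequality.  Bootstrap `1/3 → 1/2` on the Nash class by
the LANDED theorem `NashTwoShellGapNashSeparation.stub_nashSeparation` (p158426); a configuration with at most `β₀ N` bad
particles is priced by the dilute stub; one with more is periodised (`CoarseTierTransfer.exists_periodicConfiguration`:
motif `= univ.image x`, long periods), its periodisation has `1/3`-separated points (`separated_points`), bad motif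
fraction `≥ β₀` (`CoerciveTwoShellGapPeriodisation.card_bad_le`) and `e(P) ≤ 𝓔(x)/N` (`energyPerParticle_le`), so the bulk
stub gives `𝓔(x) ≥ N(e* + γ) ≥ N e* + γ #bad`.  `g := min g_D γ`. [folklore] -/
theorem gap_of_bulk_of_dilute (hB : ∀ β₀ : ℝ, 0 < β₀ → ∃ γ : ℝ, 0 < γ ∧ ∀ P : Literature.MathematicalPhysics.StatisticalMechanics.PeriodicConfiguration 3, (∀ u ∈ P.points, ∀ v ∈ P.points, u ≠ v → (1 / 3 : ℝ) ≤ dist u v) → β₀ * (P.motif.card : ℝ) ≤ ((P.motif.filter fun y => ¬ Literature.Geometry.DiscreteGeometry.IsTwoShellGoodSet (1 / 20) (47 / 50) 1 P.points y).card : ℝ) → (⨅ Q : Literature.MathematicalPhysics.StatisticalMechanics.PeriodicConfiguration 3, Q.energyPerParticle Literature.MathematicalPhysics.StatisticalMechanics.lennardJones) + γ ≤ P.energyPerParticle Literature.MathematicalPhysics.StatisticalMechanics.lennardJones) (hD : ∃ β₀ : ℝ, 0 < β₀ ∧ ∃ g : ℝ, 0 < g ∧ ∀ (N : ℕ) (x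 : Fin N → EuclideanSpace ℝ (Fin 3)), (∀ i j : Fin N, i ≠ j → 1 / 2 ≤ dist (x i) (x j)) → (∀ (i : Fin N) (y : EuclideanSpace ℝ (Fin 3)), (∀ j : Fin N, j ≠ i → y ≠ x j) → Literature.MathematicalPhysics.StatisticalMechanics.siteEnergy Literature.MathematicalPhysics.StatisticalMechanics.lennardJones x i ≤ ∑ j ∈ Finset.univ.erase i, Literature.MathematicalPhysics.StatisticalMechanics.lennardJones (dist y (x j))) → (Nat.card {i : Fin N // ¬ Literature.Geometry.DiscreteGeometry.IsTwoShellGood (1 / 20) (47 / 50) 1 x i} : ℝ) ≤ β₀ * N → (N : ℝ) * (⨅ Q : Literature.MathematicalPhysics.StatisticalMechanics.PeriodicConfiguration 3, Q.energyPerParticle Literature.MathematicalPhysics.StatisticalMechanics.lennardJones) + g * (Nat.card {i : Fin N // ¬ Literature.Geometry.DiscreteGeometry.IsTwoShellGood (1 / 20) (47 / 50) 1 x i} : ℝ) ≤ Literature.MathematicalPhysics.StatisticalMechanics.interactionEnergy Literature.MathematicalPhysics.StatisticalMechanics.lennardJones x) : ∃ g : ℝ, 0 < g ∧ ∀ (N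 : ℕ) (x : Fin N → EuclideanSpace ℝ (Fin 3)), (∀ i j : Fin N, i ≠ j → 1 / 3 ≤ dist (x i) (x j)) → (∀ (i : Fin N) (y : EuclideanSpace ℝ (Fin 3)), (∀ j : Fin N, j ≠ i → y ≠ x j) → Literature.MathematicalPhysics.StatisticalMechanics.siteEnergy Literature.MathematicalPhysics.StatisticalMechanics.lennardJones x i ≤ ∑ j ∈ Finset.univ.erase i, Literature.MathematicalPhysics.StatisticalMechanics.lennardJones (dist y (x j))) → (N : ℝ) * (⨅ Q : Literature.MathematicalPhysics.StatisticalMechanics.PeriodicConfiguration 3, Q.energyPerParticle Literature.MathematicalPhysics.StatisticalMechanics.lennardJones) + g * (Nat.card {i : Fin N // ¬ Literature.Geometry.DiscreteGeometry.IsTwoShellGood (1 / 20) (47 / 50) 1 x i} : ℝ) ≤ Literature.MathematicalPhysics.StatisticalMechanics.interactionEnergy Literature.MathematicalPhysics.StatisticalMechanics.lennardJones x := by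
  revert hB hD
  intro hB hD
  obtain ⟨β₀, hβ₀, gD, hgD, hD⟩ := hD
  obtain ⟨γ, hγ, hB⟩ := hB β₀ hβ₀
  refine ⟨min gD γ, lt_min hgD hγ, ?_⟩
  intro N x h3 hnash
  -- (0) separation bootstrap on the Nash class (landed p158426)
  have h2 : ∀ i j : Fin N, i ≠ j → 1 / 2 ≤ dist (x i) (x j) :=
    NashTwoShellGapNashSeparation.stub_nashSeparation N x h3 hnash
  set e : ℝ := ⨅ Q : PeriodicConfiguration 3, Q.energyPerParticle lennardJones with he
  set B : ℕ := Nat.card {i : Fin N // ¬ IsTwoShellGood (1 / 20) (47 / 50) 1 x i} with hBdef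
  have hB0 : (0 : ℝ) ≤ (B : ℝ) := Nat.cast_nonneg _
  have hBN : (B : ℝ) ≤ N := by
    have : B ≤ N := (Finite.card_subtype_le _).trans_eq (Nat.card_fin N)
    exact_mod_cast this
  by_cases hdil : (B : ℝ) ≤ β₀ * N
  · -- (1) dilute: the Nash-class dilute stub, then shrink the price to `min gD γ ≤ gD`
    have eD := hD N x h2 hnash hdil
    have m1 : min gD γ * (B : ℝ) ≤ gD * (B : ℝ) := mul_le_mul_of_nonneg_right (min_le_left gD γ) hB0
    linarith [eD, m1]
  · -- (2) dense: periodise and apply the bulk stub on the torus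
    push Not at hdil
    rcases Nat.eq_zero_or_pos N with hN0 | hN
    · subst hN0
      have hB00 : (B : ℝ) = 0 := by
        have : B ≤ 0 := (Finite.card_subtype_le _).trans_eq (Nat.card_fin 0)
        exact_mod_cast Nat.le_zero.1 this
      simp [interactionEnergy, hB00]
    · have hx : Function.Injective x := CoarseTierTransfer.injective_of_separated h3
      obtain ⟨P, hPm, hPl⟩ := CoarseTierTransfer.exists_periodicConfiguration x hN
      have hsepP := CoarseTierTransfer.separated_points hPm hPl h3
      have hcardm : (P.motif.card : ℝ) = N := by
        rw [hPm, Finset.card_image_of_injective _ hx]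
        simp
      have hcnt : (B : ℝ) ≤
          ((P.motif.filter fun y => ¬ IsTwoShellGoodSet (1 / 20) (47 / 50) 1 P.points y).card : ℝ) := by
        exact_mod_cast CoerciveTwoShellGapPeriodisation.card_bad_le hPm hPl hx
      have hfrac : β₀ * (P.motif.card : ℝ) ≤
          ((P.motif.filter fun y => ¬ IsTwoShellGoodSet (1 / 20) (47 / 50) 1 P.points y).card : ℝ) := by
        rw [hcardm]; linarith
      have key := hB P hsepP hfrac
      have hle := CoarseTierTransfer.energyPerParticle_le hPm hPl hx hN
      have hNr : (0 : ℝ) < N := by exact_mod_cast hN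
      have h4 : e + γ ≤ interactionEnergy lennardJones x / N := key.trans hle
      rw [le_div_iff₀ hNr] at h4
      have m2 : min gD γ * (B : ℝ) ≤ γ * (B : ℝ) := mul_le_mul_of_nonneg_right (min_le_right gD γ) hB0
      have m3 : γ * (B : ℝ) ≤ γ * N := mul_le_mul_of_nonneg_left hBN hγ.le
      nlinarith [h4, m2, m3]


/-- **Registered sub-goal `stub_bulkDiluteComposition`** — line `bulk_dilute`'s composition as a tree theorem:
the flat bad-phase gap on the torus and the dilute Nash gap imply the crux BY NAME. [folklore] -/
theorem stub_bulkDiluteComposition : (∀ β₀ : ℝ, 0 < β₀ → ∃ γ : ℝ, 0 < γ ∧ ∀ P : Literature.MathematicalPhysics.StatisticalMechanics.PeriodicConfiguration 3, (∀ u ∈ P.points, ∀ v ∈ P.points, u ≠ v → (1 / 3 : ℝ) ≤ dist u v) → β₀ * (P.motif.card : ℝ) ≤ ((P.motif.filter fun y => ¬ Literature.Geometry.DiscreteGeometry.IsTwoShellGoodSet (1 / 20) (47 / 50) 1 P.points y).card : ℝ) → (⨅ Q : Literature.MathematicalPhysics.StatisticalMechanics.PeriodicConfiguration 3, Q.energyPerParticle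 Literature.MathematicalPhysics.StatisticalMechanics.lennardJones) + γ ≤ P.energyPerParticle Literature.MathematicalPhysics.StatisticalMechanics.lennardJones) → (∃ β₀ : ℝ, 0 < β₀ ∧ ∃ g : ℝ, 0 < g ∧ ∀ (N : ℕ) (x : Fin N → EuclideanSpace ℝ (Fin 3)), (∀ i j : Fin N, i ≠ j → 1 / 2 ≤ dist (x i) (x j)) → (∀ (i : Fin N) (y : EuclideanSpace ℝ (Fin 3)), (∀ j : Fin N, j ≠ i → y ≠ x j) → Literature.MathematicalPhysics.StatisticalMechanics.siteEnergy Literature.MathematicalPhysics.StatisticalMechanics.lennardJones x i ≤ ∑ j ∈ Finset.univ.erase i, Literature.MathematicalPhysics.StatisticalMechanics.lennardJones (dist y (x j))) → (Nat.card {i : Fin N // ¬ Literature.Geometry.DiscreteGeometry.IsTwoShellGood (1 / 20) (47 / 50) 1 x i} : ℝ) ≤ β₀ * N → (N : ℝ) * (⨅ Q : Literature.MathematicalPhysics.StatisticalMechanics.PeriodicConfiguration 3, Q.energyPerParticle Literature.MathematicalPhysics.StatisticalMechanics.lennardJones) + g * (Nat.card {i : Fin N // ¬ Literature.Geometry.DiscreteGeometry.IsTwoShellGood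 (1 / 20) (47 / 50) 1 x i} : ℝ) ≤ Literature.MathematicalPhysics.StatisticalMechanics.interactionEnergy Literature.MathematicalPhysics.StatisticalMechanics.lennardJones x) → Summit.AtomisticToContinuum.Crystallization.Theses.NashClassCertificates.NashTwoShellGap :=
  fun hB hD => gap_of_bulk_of_dilute hB hD

/-- **Given the bulk gap, the crux IS the dilute Nash gap**: under `stub_badPhaseGap` the crux
`NashTwoShellGap` is equivalent to its restriction to sparsely-bad `1/2`-separated Nash configurations
(`→`: the landed sandwich `stub_diluteOfCrux`; `←`: the composition).  So every Nash-specific content of the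
crux lives in the dilute stub. [folklore] -/
theorem nashTwoShellGap_iff_dilute_of_bulk (hB : ∀ β₀ : ℝ, 0 < β₀ → ∃ γ : ℝ, 0 < γ ∧ ∀ P : Literature.MathematicalPhysics.StatisticalMechanics.PeriodicConfiguration 3, (∀ u ∈ P.points, ∀ v ∈ P.points, u ≠ v → (1 / 3 : ℝ) ≤ dist u v) → β₀ * (P.motif.card : ℝ) ≤ ((P.motif.filter fun y => ¬ Literature.Geometry.DiscreteGeometry.IsTwoShellGoodSet (1 / 20) (47 / 50) 1 P.points y).card : ℝ) → (⨅ Q : Literature.MathematicalPhysics.StatisticalMechanics.PeriodicConfiguration 3, Q.energyPerParticle Literature.MathematicalPhysics.StatisticalMechanics.lennardJones) + γ ≤ P.energyPerParticle Literature.MathematicalPhysics.StatisticalMechanics.lennardJones) :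
    Summit.AtomisticToContinuum.Crystallization.Theses.NashClassCertificates.NashTwoShellGap ↔ (∃ β₀ : ℝ, 0 < β₀ ∧ ∃ g : ℝ, 0 < g ∧ ∀ (N : ℕ) (x : Fin N → EuclideanSpace ℝ (Fin 3)), (∀ i j : Fin N, i ≠ j → 1 / 2 ≤ dist (x i) (x j)) → (∀ (i : Fin N) (y : EuclideanSpace ℝ (Fin 3)), (∀ j : Fin N, j ≠ i → y ≠ x j) → Literature.MathematicalPhysics.StatisticalMechanics.siteEnergy Literature.MathematicalPhysics.StatisticalMechanics.lennardJones x i ≤ ∑ j ∈ Finset.univ.erase i, Literature.MathematicalPhysics.StatisticalMechanics.lennardJones (dist y (x j))) → (Nat.card {i : Fin N // ¬ Literature.Geometry.DiscreteGeometry.IsTwoShellGood (1 / 20) (47 / 50) 1 x i} : ℝ) ≤ β₀ * N → (N : ℝ) * (⨅ Q : Literature.MathematicalPhysics.StatisticalMechanics.PeriodicConfiguration 3, Q.energyPerParticle Literature.MathematicalPhysics.StatisticalMechanics.lennardJones) + g * (Nat.card {i : Fin N // ¬ Literature.Geometry.DiscreteGeometry.IsTwoShellGood (1 / 20) (47 /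 50) 1 x i} : ℝ) ≤ Literature.MathematicalPhysics.StatisticalMechanics.interactionEnergy Literature.MathematicalPhysics.StatisticalMechanics.lennardJones x) :=
  ⟨NashTwoShellGapDiluteOfCrux.stub_diluteOfCrux, fun hD => gap_of_bulk_of_dilute hB hD⟩

end Summit.AtomisticToContinuum.Crystallization.Theorems.NashTwoShellGapBulkDiluteComposition

end
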